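import Mathlib
import HarnessLib
import HarnessLib.Audit
import Summits.QuantumAdvantage.Statement
import Summits.QuantumAdvantage.AdviceFreeQNC0.AdviceFreeQNC0
import Summits.QuantumAdvantage.AdviceFreeQNC0.RingHardOdd
import Summits.QuantumAdvantage.AdviceFreeQNC0.RingCanonical
import Summits.QuantumAdvantage.QuantumAdvantage.Theorems.RingFrameBridge
import Summits.QuantumAdvantage.AdviceFreeQNC0.AdviceFreeQNC0Three
import Summits.QuantumAdvantage.AdviceFreeQNC0.PredHard
import HarnessLib.Audit.Status.Attr

/-!
Route: DWalkThree

# Route DWalkThree — Cycle-HLF beats FAC0[3] on the odd class because the D-walk on Z/3 hides one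
near-uniform trit

RUNG ROUTE (D-0059/D-0061/D-0145; rung F-Q2-odd3; intended `closes_target` = the rung leaf
`Summit.QuantumAdvantage.AdviceFreeQNC0.AdviceFreeQNC0Sep 3` = advice-free QNC⁰ ⊄ FAC⁰[3] with
uniform shared randomness for a relation family — NOT the summit Statement `QuantumAdvantage`, BQP ⊄
BPP untouched; born draft until the operator mints that leaf; sibling of qn-p2's `OddPrimeWalk` (p ≥
5)). It suffices to show X = `RingTwoThirds3`: for every ε > 0 and c, for all large cycle lengths n,
every tuple of 𝔽₃-polynomials P_i of degree ≤ (log₂ n)^c answers the n-cycle graph-state relation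
`RingHLF.Rel` on at most (2/3 + ε)·2^(n−1) of the 2^(n−1) ODD measurement patterns (odd number of
zeros); the landed chain `ringHardOfOdd 3` (give away the even class) and
`adviceFreeQNC0Sep_of_ringHard 3` (Razborov–Smolensky + BGK) turns X into the leaf. X is cut as R0 ∧
A ∧ (R0 → A → X): R0 = `RingFixedBellsSharp3` (all constant strategies, memo-proved), A =
`RingBShot3` (THEOREM A: ≤ n^(1/4) adaptive deviations from the canonical guess, memo-proved by
gauge transport), and the dense residual `RingDenseResidual3` (the crux).
Lean: `RingFixedBellsSharp3 → RingBShot3 → RingDenseResidual3 →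
Summit.QuantumAdvantage.AdviceFreeQNC0.AdviceFreeQNC0Sep 3`

## Assembly
Pure logic plus two landed theorems: `hD hR0 hA : RingTwoThirds3`; instantiate ε = 1/6 to get
`RingHardOdd 3` with θ = 5/6; `ringHardOfOdd 3` gives `RingHard 3` (θ′ = 11/12);
`Theorems.adviceFreeQNC0Sep_of_ringHard 3` gives the leaf `AdviceFreeQNC0Sep 3` (glue.lean `closes`,
kernel-checked in HOME/qa-qnc0-p1/Sketch20.lean).

CLOSES_TARGET: closes rung F-Q1-p3 of QuantumAdvantage: Summit.QuantumAdvantage.AdviceFreeQNC0.AdviceFreeQNC0Three (D-0061; not the summit Statement) — the deciding theorem of this route concludes that registered leaf instead of the Statement decl `QuantumAdvantage` (class rung: servable and labelled, never counted as concluding the summit Statement).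

Rationale: WHY THIS LINE. On the odd class the ring game has an exact normal form (cell ROUND-14 §4ter, tree
`avoidNormalForm`/`chargePair`, arXiv:1704.00690 for the relation): the hidden data is a ±1 walk D_k
on ℤ/3 whose start E is its own total displacement, a deviation ("bell") at cut k scores iff D_k ≠
1, and the player — who sees only the TURNS of the walk at polylog 𝔽₃-degree — wins iff an odd
number of bells score. Two exact identities drive everything: E1 odd-one-out (for any bell set and
residues c_k, evenly many T ∈ ℤ/3 make ⊕[T ≠ c_k] true) and E2 unread-gap (a bell-free, unread
window of m walk steps is a hidden near-uniform trit entering every live-condition as [a_k·T ≠ c_k],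
so the value is ≤ 2/3 + (4/3)2^(−m) for players of ANY complexity). R0 (constant strategies) follows
from E2 plus a 3×3 transfer-matrix certificate (‖M_g M_h‖_F² = (1+8α_g²+8α_h²+10α_g²α_h²)/9 ≤ 5/8);
THEOREM A imports Kilian's randomized self-reduction of group words (S₃ ≅ AGL(1,𝔽₃) letters z ↦
±z+κ; a uniform gauge on block products of a bell-free window makes the window law a function of the
hidden trit alone) and pays the reading player off with the tree's two-sided Smolensky bound
`Smolensky.parity_agreement_le` (Razborov–Smolensky 1987/1993), because after transport every
residual dependence is a parity of ≥ n^(1/2−o(1)) independent bits. What prior routes do not do: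
RingFrame (p = 2, CLOSED) bets 𝔽₂-polynomials against a mod-3 walk (parity is free there, MOD₃ is
hard); here the roles swap — MOD₃ is free for the 𝔽₃-player and the hidden structure is a
PARITY-modulated walk, so the u-coordinate relaxation is false (`not_walkHardF_three`) and the
protection is the parity chart; p2's OddPrimeWalk (p ≥ 5) has both moduli hard and is a different
regime.

RANKED CRUXES. #0 RingTwoThirds3 (target) — X — the 2/3 + ε law for all polylog-degree 𝔽₃-strategies
on the odd class of the n-cycle (value 2/3 is attained by a single deviation, so 2/3 is sharp; the
leaf needs only some θ < 1). (why it might fail: a dense adaptive strategy could correlate its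
deviations with the hidden class walk c_(k+1) = c_k + s_k (turns visible, signs hidden) and beat 2/3
by Ω(1); every kit search (two-rung bells, radius ≤ 2 local rules, degree ≤ 2 hill-climbs, N ≤ 14)
sits at 2/3 + O(2^−N), no proof.) [arXiv:1704.00690, arXiv:1906.08890, arXiv:2209.14158]
#2 RingDenseResidual3 (crux) — the DENSE RESIDUAL — given R0 (every constant strategy) and THEOREM A
(every strategy with ≤ n^(1/4) adaptive deviations per odd input), every polylog-degree 𝔽₃-strategy
obeys the 2/3 + ε law. Minimal sufficient form recorded (ROUND-15 §9.3, (D3-core′)(M)): after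
conditioning on the walk outside a head block of M = polylog n steps, the outer bells collapse by E1
to three parities π_r ∈ Π_(d,n) (XORs of ≤ n Boolean 𝔽₃-degree-d functions of the block) and one
needs Pr[head game ⊕ [T ≠ oddOneOut(π)]] ≤ 2/3 + o(1): a PARITY∘MOD₃∘AND_polylog versus
MOD₃∘⊕-prefix average-case bound. [deps: RingFixedBellsSharp3, RingBShot3] [difficulty:
open-problem] (why it might fail: (D3-core′) is FALSE for M ≤ log₂ n (𝔽₂-span of Boolean
𝔽₃-quadratics = all functions); for M = polylog it is a depth-3 two-moduli average-case bound of
Constant-Degree-Hypothesis type, open in print; conditioning may give away hidden classes the game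
keeps.) [arXiv:2604.04760, arXiv:2209.14158, doi:10.1007/BF01200404]
#3 RingBShot3 (crux) — THEOREM A (B-shot law) — for every ε > 0 and c, for large n, every
degree-(log₂ n)^c 𝔽₃-strategy whose answer deviates from the canonical guess `tGuess x` in at most
n^(1/4) positions on every odd input x wins on at most (2/3 + ε)·2^(n−1) odd inputs. Memo-level
proof (ROUND-15 §3, §9): random bell-free unread-in-effect window of m ≈ n^(1/2) steps (sparsity),
Kilian gauge on its block products (S₃ word, uniform on the T-fibre), fibre-resampling lift of the
strategy (degree × O(log n)), E1 on the structured law, and `Smolensky.parity_agreement_le` for the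
residual parities; error Õ(√d·n^(−1/4)). [difficulty: L] (why it might fail: the law-comparison step
L5 (lifted strategy under the structured law ν_K vs the true law) is prose only; if window reading
cannot be charged to parities of ≥ n^(1/2−o(1)) fresh bits the Smolensky payoff degrades to O(1) and
only B = O(1) deviations survive.) [doi:10.1145/62212.62215, arXiv:2209.14158,
doi:10.1007/BF01200404]
#9 RingFixedBellsSharp3 (support) — R0 — every CONSTANT strategy tGuess ⊕ 1_B (any fixed bell set B
⊆ Fin N, any size, N ≥ 3) wins on at most (2/3)·2^(N−1) + (1/3)·2^(N−⌊(N−20)/21⌋) odd inputs: ≤ 20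
bells leave a bell-free run of ⌊(N−20)/21⌋ consecutive cuts and the tree's `fixedBellsInnerGap3` (c
= 1) applies; ≥ 21 bells: Σ_x(−1)^WIN is a twisted trace of F/P-products (P = ±1 step on ℤ/3, F =
diag(−1,1,−1)), consecutive normalised gap blocks satisfy ‖M_g M_h‖_F² ≤ 5/8, so |E(−1)^WIN| ≤
√3(5/8)^5 < 1/5 (ROUND-15 §9.7; statements `TransferMatrixForm3`/`PairContraction3` typed, sanity
instances kernel-decided in HOME/qa-qnc0-p1/Sketch19c.lean). [difficulty: M] [arXiv:1704.00690,
doi:10.1007/BF01200404]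

TWO-LAYER PLAN. RingBShot3 ⇐ E2 `RingUnreadGap3` (any-complexity unread-gap bound, S given E1) →
`TransportToUnread3` (Kilian gauge + fibre lift + Smolensky: a B-shot polylog strategy is within
o(2^n) of an unread-window strategy on a random window; L) → RingBShot3; first registered skeleton
`Lines/birth.lean` carries exactly these stubs plus E1 `OddOneOut`. RingDenseResidual3 ⇐
(D3-core′)(polylog) → residual, once (D3-core′) is typed; R0's skeleton: `TransferMatrixForm3` →
`PairContraction3` → `FixedBellsDense3`, and `fixedBellsInnerGap3` (landed) for the sparse branch.

KILL CRITERIA. A refutation of RingTwoThirds3 or of RingHardOdd 3 itself (a polylog-degree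
𝔽₃-strategy winning on ≥ (1 − o(1)) of odd patterns; cheapest candidates: dense
translation-invariant local rules × one global MOD₃ gate, kit-searchable to N = 16) closes the route
`refuted:RingTwoThirds3` and kills rung F-Q2-odd3 for the cycle (the leaf may survive on other
graphs). A refutation of RingBShot3 alone (some n^(1/4)-sparse adaptive strategy beating 2/3 + Ω(1))
forces a pivot to B = O(1) (E3-type items, still a rung). Refutation of RingFixedBellsSharp3 is
impossible modulo arithmetic slips (finite certificate; exhaustive N ≤ 12 agrees) — a slip is
repaired by restating the constant.

NOT DECOMPOSED YET. The dense residual is deliberately ONE node: its only typed sufficient form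
(D3-core′) has a known false regime (M ≤ log₂ n) and may be strictly stronger than needed (it hands
the player the hidden classes); it is split only when a mechanism keeping the classes hidden, or a
two-moduli correlation bound at polylog degree, is in hand. Constants (n^(1/4), 21 bells, 5/8) are
not optimised. The p ≥ 5 analogue is qn-p2's sibling route, not duplicated here.

CHEAPEST FALSIFIER. Kit search for a dense strategy beating 2/3 at N = 12–16: bells = (radius ≤ 3
translation-invariant local rule) × (one global gate [Σx ≡ a mod 3] or [#zeros ≡ a mod 4]), exact
value by transfer operator (state = walk residue × rule window × gate counter), minutes per family;
any family with value ≥ 0.70 stable in N kills RingTwoThirds3 as the thesis (the leaf would still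
allow θ < 1). Ran so far (cell kit j244296…j288231, p2's automata j286479/j287087): every measured
class ≤ 2/3 + O(2^−N); exact deg-1 prediction advantage for D_k: 0.054/0.037/0.037 at N = 12/13/14
(j288231), consistent with THEOREM A′.

NUMBERS. Value of a single deviation: exactly 2/3 − O(2^−N) (tree `chargePair`; kit tables N ≤ 14).
E2: 2/3 + (4/3)·2^(−m) for an unread bell-free window of m steps (exhaustive N ≤ 10, kernel-decided
N = 6). R0 dense certificate: ‖M_g M_h‖_F² = (1 + 8·4^(−g) + 8·4^(−h) + 10·4^(−g−h))/9 ≤ 5/8, JSR ≤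
0.80, ≥ 21 bells ⇒ value ≤ 0.59. THEOREM A error: Õ((d²L³K/n)^(1/4)) with L = Θ(log n) block length,
K ≈ n^(1/2) blocks, ceiling B·m ≪ n ⇒ B ≤ n^(1/3−o(1)) (item states n^(1/4)).

DEFINITION REQUESTS. None for opening (all items over tree declarations). After open: D1 the D-walk
vocabulary (`sgn3/Mk3/Dk3`, HOME/qa-qnc0-p1/Sketch19.lean) as a Theorems defs file when a prover
wants E1/E2/TransferMatrixForm3 by name (`--topic
Summits/QuantumAdvantage/QuantumAdvantage/Theorems`).

Novelty: Searches (2026-08-27): lit search --hybrid "Kilian randomized self reduction group word Smolensky"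
(0 relevant; NC¹ randomizing polynomials only), lit galaxy search "MOD p-MOD q
circuits|MODp-MODq|MOD_p o MOD_q" --star all (0), lit search --hybrid "exact degree symmetric
boolean function composite modulus periodic" (hits: [corpus:paper:arxiv-2604.04760 p.3] citing
Grolmusz–Tardos 2000 and Straubing 2006 for MOD_p∘MOD_q lower bounds; Jukna 2012 generic), lean
search 'parity_agreement_le|modq_agreement_le|card_agree_modIndicator_le' (tree, one- /two-sided
Smolensky forms), ledger negatives --problem QuantumAdvantage (u-relaxation `WalkHardF 3` refuted by
`not_walkHardF_three`; `RingHardOddHalf` dead by one-flip 2/3).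
Nearest prior art found: arXiv:2209.14158 / doi:10.46298/theoretics.23.5 (Srinivasan 2023, robust
Hegedűs: the p = 2 engine of RingFrame), doi:10.1145/62212.62215 (Kilian 1988, randomizing group
products for oblivious transfer/NC¹), doi:10.1007/BF01200404 (Smolensky 1993, MOD_q vs 𝔽_p
polynomials), arXiv:1704.00690 and arXiv:1906.08890 (BGK 2018 / WKST 2019: the relation and the p =
2 separation with advice).
Delta: nobody has used a Kilian-type gauge on the S₃ ≅ AGL(1,𝔽₃) word of the cycle's hidden walk to
make a low-degree READING player provably blind to a window (transport), nor reduced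
FAC⁰[3]-hardness of cycle-HLF to a single two-moduli residual; the p = 3 case is absent from print
(GK 2024 §1.3 asks the circuit question for odd p).
Claimed grade: new-combinat  [refs: 10.46298/theoretics.23.5, 10.1145/62212.62215, 10.1007/BF01200404, 2209.14158, 1704.00690, 1906.08890, paper:arxiv-2604.04760, doi:10.46298/theoretics.23.5, doi:10.1145/62212.62215, doi:10.1007/BF01200404, paper:doi-10-1145-2488608-2488640, paper:doi-10-1016-0890-5401-90-90007-5, paper:doi-10-4230-lipics-itcs-2022-80, paper:galaxy-pdf-8080605037482983460, Kilian1988, MilesViola2013]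

Barriers (technique_class: polynomial-method, razborov-smolensky, kilian-rsr): - technique_class: polynomial-method, razborov-smolensky, kilian-rsr
- Literature.Barriers.QuantumAdvantage.NaturalProofs: inside the class and not obstructed — the
items are lower bounds against polylog-degree 𝔽₃-polynomial tuples (⊇ FAC⁰[3] after
Razborov–Smolensky), a class with no pseudorandom functions, where natural (largeness +
constructivity) arguments such as Smolensky's are exactly what works; the barrier quantifies over
classes containing PRFs (TC⁰ and up), which this rung does not touch.
- Literature.Barriers.QuantumAdvantage.Relativization: does not apply — a fixed combinatorial
inequality about polynomials on the n-cycle relation, no oracle machines; the rung is explicitly not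
BQP ⊄ BPP.
- Literature.Barriers.QuantumAdvantage.Algebrization: does not apply for the same reason (no
low-degree oracle extension is in play; the statement is a concrete constant-depth/low-degree
bound).
- Literature.Barriers.QuantumAdvantage.SeparationPrerequisites: does not apply — the leaf is a
relation-problem separation against FAC⁰[3] with uniform randomness, not a decision-class separation
needing derandomization prerequisites.
- Literature.Barriers.QuantumAdvantage.TotalFunctionSpeedupLimit: outside the class — relation
problem with certainty on the quantum side (BGK), no total-function query speedup claimed.
- Literature.Barriers.QuantumAdvantage.TwoModuliDepthTwo (landed p575457; BST90 Thm 7 + §7, circuit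
form KP97/GT2000 = CDH at bottom fan-in 1): ADJACENT, not inside — the SH

History (route lifecycle, newest last):
- 2026-08-27T21:55:33Z · closes_target -> closes rung F-Q1-p3 of QuantumAdvantage: Summit.QuantumAdvantage.AdviceFreeQNC0.AdviceFreeQNC0Three (D-0061; not the summit Statement) (planner-qa-qnc0-p1-g17-0)

sub-problem: QuantumAdvantage · status: draft · opened planner-qa-qnc0-p1-g16-0 2026-08-27T20:54:30Z · rev 5 · ledger route-QuantumAdvantage-DWalkThree
GENERATED by the gate from the ledger (D-0016/17). Provers cite these decls: `theorem foo : Summit.QuantumAdvantage.QuantumAdvantage.Theses.DWalkThree.<Decl> := …` in Summits/QuantumAdvantage/QuantumAdvantage/Theorems/<Name>.lean.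
-/

namespace Summit.QuantumAdvantage.QuantumAdvantage.Theses.DWalkThree

open scoped BigOperators Topology Manifold Classical MeasureTheory ProbabilityTheory Matrix InnerProductSpace ComplexConjugate ContinuousMap
open Filter Set Function TopologicalSpace MeasureTheory

attribute [summit_statement] _root_.QuantumAdvantage
attribute [summit_statement] _root_.Summit.QuantumAdvantage.AdviceFreeQNC0.AdviceFreeQNC0Three

open Literature.QuantumAdvantage

/-- item stmt-QuantumAdvantage-22486 · crux · rank 3 · closed · proved by Summit.QuantumAdvantage.QuantumAdvantage.Theorems.dWalkThree_ringBShot3 (prover) · by planner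
why it might fail: the law-comparison step L5 (lifted strategy under the structured law ν_K vs the true law) is prose only; if window reading cannot be charged to parities of ≥ n^(1/2−o(1)) fresh bits the Smolensky payoff degrades to O(1) and only B = O(1) deviations survive.
sources: doi:10.1145/62212.62215, arXiv:2209.14158, doi:10.1007/BF01200404
[crux] THEOREM A (B-shot law) — for every ε > 0 and c, for large n, every degree-(log₂ n)^c
𝔽₃-strategy whose answer deviates from the canonical guess `tGuess x` in at most n^(1/4) positions
on every odd input x wins on at most (2/3 + ε)·2^(n−1) odd inputs. Memo-level proof (ROUND-15 §3,
§9): random bell-free unread-in-effect window of m ≈ n^(1/2) steps (sparsity), Kilian gauge on its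
block products (S₃ word, uniform on the T-fibre), fibre-resampling lift of the strategy (degree ×
O(log n)), E1 on the structured law, and `Smolensky.parity_agreement_le` for the residual parities;
error Õ(√d·n^(−1/4)). [difficulty: L] -/
@[route_item "route-QuantumAdvantage-DWalkThree", crux]
def RingBShot3 : Prop :=
  ∀ ε : ℝ, 0 < ε → ∀ c : ℕ, ∃ n₀ : ℕ, ∀ n ≥ n₀, ∀ P : Fin n → Literature.Computability.MetaComplexity.Smolensky.CubeFn (ZMod 3) n, (∀ i, P i ∈ Literature.Computability.MetaComplexity.Smolensky.lowDeg (ZMod 3) n ((Nat.log 2 n) ^ c)) → (∀ x : Fin n → Bool, Summit.QuantumAdvantage.AdviceFreeQNC0.OddZeros x → (Finset.univ.filter fun i : Fin n => decide (P i x = 1) ≠ Summit.QuantumAdvantage.AdviceFreeQNC0.tGuess x i).card ^ 4 ≤ n) → ((Finset.univ.filter fun x : Fin n → Bool => Summit.QuantumAdvantage.AdviceFreeQNC0.OddZeros x ∧ Literature.Computability.QuantumComplexity.RingHLF.Rel x (fun i => decide (P i x = 1))).card : ℝ) ≤ (2 / 3 + ε) * (2 : ℝ) ^ (n - 1)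

-- `RingBShot3` holds: proved by `Summit.QuantumAdvantage.QuantumAdvantage.Theorems.dWalkThree_ringBShot3` (its module imports this route file, so no `_holds` link can be stated here).

/-- item stmt-QuantumAdvantage-22484 · aside · rank 0 · open · by planner
why it might fail: a dense adaptive strategy could correlate its deviations with the hidden class walk c_(k+1) = c_k + s_k (turns visible, signs hidden) and beat 2/3 by Ω(1); every kit search (two-rung bells, radius ≤ 2 local rules, degree ≤ 2 hill-climbs, N ≤ 14) sits at 2/3 + O(2^−N), no proof.
sources: arXiv:1704.00690, arXiv:1906.08890, arXiv:2209.14158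
[target] X — the 2/3 + ε law for all polylog-degree 𝔽₃-strategies on the odd class of the n-cycle
(value 2/3 is attained by a single deviation, so 2/3 is sharp; the leaf needs only some θ < 1). -/
@[route_item "route-QuantumAdvantage-DWalkThree"]
def RingTwoThirds3 : Prop :=
  ∀ ε : ℝ, 0 < ε → ∀ c : ℕ, ∃ n₀ : ℕ, ∀ n ≥ n₀, ∀ P : Fin n → Literature.Computability.MetaComplexity.Smolensky.CubeFn (ZMod 3) n, (∀ i, P i ∈ Literature.Computability.MetaComplexity.Smolensky.lowDeg (ZMod 3) n ((Nat.log 2 n) ^ c)) → ((Finset.univ.filter fun x : Fin n → Bool => Summit.QuantumAdvantage.AdviceFreeQNC0.OddZeros x ∧ Literature.Computability.QuantumComplexity.RingHLF.Rel x (fun i => decide (P i x = 1))).card : ℝ) ≤ (2 / 3 + ε) * (2 : ℝ) ^ (n - 1)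

/-- item stmt-QuantumAdvantage-22487 · support · rank 9 · closed · proved by Summit.QuantumAdvantage.QuantumAdvantage.Theorems.dWalkThree_ringFixedBellsSharp3 (prover) · by planner
sources: arXiv:1704.00690, doi:10.1007/BF01200404
[support] R0 — every CONSTANT strategy tGuess ⊕ 1_B (any fixed bell set B ⊆ Fin N, any size, N ≥ 3)
wins on at most (2/3)·2^(N−1) + (1/3)·2^(N−⌊(N−20)/21⌋) odd inputs: ≤ 20 bells leave a bell-free run
of ⌊(N−20)/21⌋ consecutive cuts and the tree's `fixedBellsInnerGap3` (c = 1) applies; ≥ 21 bells: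
Σ_x(−1)^WIN is a twisted trace of F/P-products (P = ±1 step on ℤ/3, F = diag(−1,1,−1)), consecutive
normalised gap blocks satisfy ‖M_g M_h‖_F² ≤ 5/8, so |E(−1)^WIN| ≤ √3(5/8)^5 < 1/5 (ROUND-15 §9.7;
statements `TransferMatrixForm3`/`PairContraction3` typed, sanity instances kernel-decided in
HOME/qa-qnc0-p1/Sketch19c.lean). [difficulty: M] -/
@[route_item "route-QuantumAdvantage-DWalkThree", crux]
def RingFixedBellsSharp3 : Prop :=
  ∀ N : ℕ, 3 ≤ N → ∀ B : Finset (Fin N), 3 * (Finset.univ.filter fun x : Fin N → Bool => Summit.QuantumAdvantage.AdviceFreeQNC0.OddZeros x ∧ Literature.Computability.QuantumComplexity.RingHLF.Rel x (fun k => xor (Summit.QuantumAdvantage.AdviceFreeQNC0.tGuess x k) (decide (k ∈ B)))).card ≤ 2 * 2 ^ (N - 1) + 2 ^ (N - (N - 20) / 21)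

-- `RingFixedBellsSharp3` holds: proved by `Summit.QuantumAdvantage.QuantumAdvantage.Theorems.dWalkThree_ringFixedBellsSharp3` (its module imports this route file, so no `_holds` link can be stated here).

/-- item stmt-QuantumAdvantage-22907 · crux · rank 2 · open · by planner
why it might fail: a dense adaptive 𝔽₃-strategy (local rules gated by global MOD₃ moments) could steer its hidden bin-parity triple n(x) so the dead residue 1 − oddOneOut(n(x)) avoids E(x) w.p. 1 − o(1); no two-moduli MOD₂∘MOD₃∘AND vs MOD₃∘⊕ average-case tool in print; transport costs degree × #windows.
sources: doi:10.1145/28395.28404, arXiv:2209.14158, doi:10.1007/BF01200404, arXiv:1906.08890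
[crux] the DENSE RESIDUAL, weakest-θ form — given R0 (every constant strategy: RingFixedBellsSharp3)
and THEOREM A (every polylog-degree 𝔽₃-strategy with ≤ n^(1/4) deviations from tGuess per odd input:
RingBShot3), SOME θ < 1 bounds the number of odd inputs on which an arbitrary polylog-degree
𝔽₃-strategy satisfies the ring relation by θ·2^(n−1) for all large n (= the tree decl RingHardOdd
3). Conjectured truth θ = 2/3 + ε (aside RingDenseResidual3 ⟹ this, θ = 5/6); the leaf needs only θ
< 1. Normal form (ROUND-16 §1): LOSE(x) iff the hidden endpoint E(x) ∈ ℤ/3 equals 1 −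
oddOneOut(n(x)), n_ρ(x) = parity of ringing bells k with hidden partial sum S_k(x) = ρ; so the crux
is: E is not avoidable, with constant probability, by dead-residue functions produced through
hidden-binned low-degree marks. [deps: RingFixedBellsSharp3, RingBShot3] [difficulty: open-problem] -/
@[route_item "route-QuantumAdvantage-DWalkThree", crux]
def RingDenseResidualLt3 : Prop :=
  RingFixedBellsSharp3 → RingBShot3 → Summit.QuantumAdvantage.AdviceFreeQNC0.RingHardOdd 3

/-- item stmt-QuantumAdvantage-22485 · aside · rank 2 · open · by planner
why it might fail: (D3-core′) is FALSE for M ≤ log₂ n (𝔽₂-span of Boolean 𝔽₃-quadratics = all functions); for M = polylog it is a depth-3 two-moduli average-case bound of Constant-Degree-Hypothesis type, open in print; conditioning may give away hidden classes the game keeps.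
sources: arXiv:2604.04760, arXiv:2209.14158, doi:10.1007/BF01200404
[crux] the DENSE RESIDUAL — given R0 (every constant strategy) and THEOREM A (every strategy with ≤
n^(1/4) adaptive deviations per odd input), every polylog-degree 𝔽₃-strategy obeys the 2/3 + ε law.
Minimal sufficient form recorded (ROUND-15 §9.3, (D3-core′)(M)): after conditioning on the walk
outside a head block of M = polylog n steps, the outer bells collapse by E1 to three parities π_r ∈
Π_(d,n) (XORs of ≤ n Boolean 𝔽₃-degree-d functions of the block) and one needs Pr[head game ⊕ [T ≠
oddOneOut(π)]] ≤ 2/3 + o(1): a PARITY∘MOD₃∘AND_polylog versus MOD₃∘⊕-prefix average-case bound.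
[deps: RingFixedBellsSharp3, RingBShot3] [difficulty: open-problem] -/
@[route_item "route-QuantumAdvantage-DWalkThree"]
def RingDenseResidual3 : Prop :=
  RingFixedBellsSharp3 → RingBShot3 → RingTwoThirds3

/-- item stmt-QuantumAdvantage-22506 · aside · rank 9 · closed · proved by Summit.QuantumAdvantage.QuantumAdvantage.Theorems.dWalkThree_ringUnreadGap3 (prover) · by planner
[support] E2 unread-gap bound in ring language (complexity-free): a strategy f that never deviates
from tGuess on output positions a..a+w for odd inputs (window cuts bell-free) and whose deviation
pattern is independent of the window bits a ≤ j < a+w (unread) wins on at most (2/3)·2^(N−1) +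
(1/3)·2^(N+3−w) odd inputs. Proof plan: condition on outside bits + window flip parity; window
step-sum T mod 3 enters every live condition as [±T ≠ c_k]; E1 odd-one-out; min-mass of T ≥ 1/3 −
(4/3)2^(−w) (HOME/qa-qnc0-p1/ROUND-15.md §9.1, §9.8 erratum; exp16/window_bias_parity.py). Fixed-B
special case = landed fixedBellsInnerGap3. First stub of the RingBShot3 skeleton
(RingBShot3_birth.lean). Why it might fail: an off-by-one in the cut↔position dictionary (4× slack
built in). Sources: arXiv:1704.00690; rung F-Q2-odd (p=3), not BQP ⊄ BPP. -/
@[route_item "route-QuantumAdvantage-DWalkThree"]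
def RingUnreadGap3 : Prop :=
  ∀ N a w : ℕ, a + w + 1 ≤ N → ∀ f : (Fin N → Bool) → (Fin N → Bool), (∀ x : Fin N → Bool, Summit.QuantumAdvantage.AdviceFreeQNC0.OddZeros x → ∀ k : Fin N, a ≤ k.val → k.val ≤ a + w → f x k = Summit.QuantumAdvantage.AdviceFreeQNC0.tGuess x k) → (∀ x x' : Fin N → Bool, (∀ j : Fin N, ¬ (a ≤ j.val ∧ j.val < a + w) → x j = x' j) → ∀ k : Fin N, (f x k = Summit.QuantumAdvantage.AdviceFreeQNC0.tGuess x k ↔ f x' k = Summit.QuantumAdvantage.AdviceFreeQNC0.tGuess x' k)) → 3 * (Finset.univ.filter fun x : Fin N → Bool => Summit.QuantumAdvantage.AdviceFreeQNC0.OddZeros x ∧ Literature.Computability.QuantumComplexity.RingHLF.Rel x (f x)).card ≤ 2 * 2 ^ (N - 1) + 2 ^ (N + 3 - w)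

-- `RingUnreadGap3` holds: proved by `Summit.QuantumAdvantage.QuantumAdvantage.Theorems.dWalkThree_ringUnreadGap3` (its module imports this route file, so no `_holds` link can be stated here).

/-- item stmt-QuantumAdvantage-22908 · aside · rank 9 · closed · proved by Summit.QuantumAdvantage.QuantumAdvantage.Theorems.dWalkThree_oddOneOut3 (prover) · by planner
sources: arXiv:1704.00690, doi:10.1145/28395.28404
[support] E1 (odd-one-out, ROUND-15 §9.1): for any finite bell family w, nonzero coefficients a_k
and offsets c_k in ℤ/3, the number of hidden trits T for which an odd number of ringing bells k have
a_k·T + c_k ≠ 1 is EVEN (hence 0 or 2 — one bell: live for exactly 2 of 3 values; induct on the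
number of ringing bells, each new bell toggles the win-indicator at exactly 2 of the 3 values of T,
preserving the parity of the count). Pure counting over ZMod 3; m = 2 is kernel-decided in
HOME/qa-qnc0-p1/edit17/Sketch21b.lean. Consumed by R0 (RingFixedBellsSharp3), E2 (RingUnreadGap3)
and the dense residual's normal form. [difficulty: S] -/
@[route_item "route-QuantumAdvantage-DWalkThree"]
def OddOneOut3 : Prop :=
  ∀ (m : ℕ) (w : Fin m → Bool) (a c : Fin m → ZMod 3), (∀ k, a k ≠ 0) → Even ((Finset.univ.filter fun T : ZMod 3 => Odd ((Finset.univ.filter fun k : Fin m => w k = true ∧ a k * T + c k ≠ 1).card)).card)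

-- `OddOneOut3` holds: proved by `Summit.QuantumAdvantage.QuantumAdvantage.Theorems.dWalkThree_oddOneOut3` (its module imports this route file, so no `_holds` link can be stated here).

/-- item stmt-QuantumAdvantage-22488 · assembly · rank 1 · closed · proved by Summit.QuantumAdvantage.QuantumAdvantage.Theorems.dWalkThree_assembly (prover) · by planner
sources: arXiv:1704.00690, arXiv:1906.08890
[assembly] R0 → THEOREM A → dense residual → AdviceFreeQNC0Sep 3 (the rung leaf; the summit
Statement is not claimed). -/
@[route_item "route-QuantumAdvantage-DWalkThree"]
def Assembly : Prop :=
  RingFixedBellsSharp3 → RingBShot3 → RingDenseResidual3 → Summit.QuantumAdvantage.AdviceFreeQNC0.AdviceFreeQNC0Sep 3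

-- `Assembly` holds: proved by `Summit.QuantumAdvantage.QuantumAdvantage.Theorems.dWalkThree_assembly` (its module imports this route file, so no `_holds` link can be stated here).

/-! D-0027 §2.1 — DECIDING THEOREM (planner-authored via `route open/edit --closes-file`; by planner-qa-qnc0-p1-g17-0 2026-08-27T21:55:33Z):
its hypotheses are this route's items and its conclusion the registered leaf `Summit.QuantumAdvantage.AdviceFreeQNC0.AdviceFreeQNC0Three` (rung F-Q1-p3, D-0061) (glue_lint), and it elaborates with this file. -/

@[closes "route-QuantumAdvantage-DWalkThree"] theorem closes (hR0 : RingFixedBellsSharp3) (hA : RingBShot3) (hD : RingDenseResidualLt3) :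
    Summit.QuantumAdvantage.AdviceFreeQNC0.AdviceFreeQNC0Three :=
  Summit.QuantumAdvantage.AdviceFreeQNC0.adviceFreeQNC0Three_of_ringHardOdd (hD hR0 hA)

end Summit.QuantumAdvantage.QuantumAdvantage.Theses.DWalkThree
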